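import Summits.CriticalPhenomena.PercolationContinuityZ3.Theorems.PercNearOneGluingNoHeavyLowerTailKnQuestion8CoefficientwiseGluing
import HarnessLib

/-!
# THEOREM ♠: the two-colouring cube form minus a sub-cube of pairs, repaired by top absorbers (prim-lf-2 gen 27)

Support file (`--supports stmt-CriticalPhenomena-4575`, closed), prover `prim-lf-2` (gen 27).  No definitions, no named facts, no sorries;
standard axioms.  Memo `prim-lf-2/CW-NEGATIVE-gen27.md` §3.

For finite sets `L ⊆ A` and monotone `f, g`, the two-colouring (Harris) form on the cube `A.powerset`, with the pairs `(s, A \ s)` for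
`s ⊇ L` REMOVED, stays nonnegative once the comparable pairs `(L ∪ J, ∅)`, `J ⊆ A \ L`, are added with weight one:
  `0 ≤ Σ_{s ⊆ A, ¬ L ⊆ s} (f s − f (A∖s))(g s − g (A∖s)) + Σ_{J ⊆ A∖L} (f (L ∪ J) − f ∅)(g (L ∪ J) − g ∅)`
(`Coefficientwise.spade`).  This is the kernel `T` of the LEMMA-G configuration sum with one free vertex `d` for the gadget graphs "x–d bridge +
single-vertex linkers `L` + pendants `A ∖ L` at `d`" (memo §3–4): weight one is the exact threshold for `|L| ≥ 2` (exhaustive check, `|A| ≤ 5`),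
while the graphs supply weight `2^{|L|}`.  Proof = induction on `|A ∖ L|`, peeling one pendant coordinate with the per-colouring identity
`(A−ā)(B−b̄) + (a−Ā)(b−B̄) = (A−Ā)(B−B̄) + (a−ā)(b−b̄) + (A−a)(B̄−b̄) + (Ā−ā)(B−b)` (`A = f(· ∪ e)`, `a = f`), whose last two terms are
products of nonnegative increments, and the observation that an absorber only gains when its lower point drops; base case = the relative Harris
form `Coefficientwise.harris_twoColouring_powerset` (the removed top pair is exactly restored by the absorber `J = ∅`).
[cite: KozmaNitzan2024, Questions 8–9 (§5.5 p. 36) (context: first rung of the coefficientwise programme for Question 8)]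
-/

namespace Summit.CriticalPhenomena.PercolationContinuityZ3.Theorems

open Finset

namespace Coefficientwise

variable {ι : Type*} [Fintype ι] [DecidableEq ι]

/-- Peeling step, pointwise: for reals with `a ≤ A`, `a' ≤ A'` (the `f`-values without/with the peeled coordinate at `s` and at `A' ∖ s`) and
`b ≤ B`, `b' ≤ B'` likewise for `g`,
`(A − a')(B − b') + (a − A')(b − B') ≥ (A − A')(B − B') + (a − a')(b − b')`.
[cite: KozmaNitzan2024, §5.5 (context only; elementary algebra)] -/
theorem spade_pointwise (A a A' a' B b B' b' : ℝ) (h1 : a ≤ A) (h2 : a' ≤ A') (h3 : b ≤ B) (h4 : b' ≤ B') :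
    (A - A') * (B - B') + (a - a') * (b - b') ≤ (A - a') * (B - b') + (a - A') * (b - B') := by
  nlinarith [mul_nonneg (sub_nonneg.mpr h1) (sub_nonneg.mpr h4), mul_nonneg (sub_nonneg.mpr h2) (sub_nonneg.mpr h3)]

/-- Absorbers only gain when the lower point drops: for `c ≤ c' ≤ x` and `d ≤ d' ≤ y`, `(x − c')(y − d') ≤ (x − c)(y − d)`.
[cite: KozmaNitzan2024, §5.5 (context only; elementary algebra)] -/
theorem absorber_mono (x y c c' d d' : ℝ) (hc : c ≤ c') (hc' : c' ≤ x) (hd : d ≤ d') (hd' : d' ≤ y) :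
    (x - c') * (y - d') ≤ (x - c) * (y - d) := by
  nlinarith [mul_nonneg (sub_nonneg.mpr hc) (sub_nonneg.mpr (le_trans hd hd')), mul_nonneg (sub_nonneg.mpr (le_trans hc hc')) (sub_nonneg.mpr hd),
    mul_nonneg (sub_nonneg.mpr hc) (sub_nonneg.mpr hd)]

/-- THEOREM ♠ in the auxiliary `if`-form, by induction on `|A ∖ L|`.
[cite: KozmaNitzan2024, Questions 8–9 (§5.5 p. 36) (context)] -/
theorem spade_aux (L : Finset ι) : ∀ (n : ℕ) (A : Finset ι), L ⊆ A → (A \ L).card = n →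
    ∀ (f g : Finset ι → ℝ), Monotone f → Monotone g →
      0 ≤ (∑ s ∈ A.powerset, (if L ⊆ s then 0 else (f s - f (A \ s)) * (g s - g (A \ s))))
          + ∑ J ∈ (A \ L).powerset, (f (L ∪ J) - f ∅) * (g (L ∪ J) - g ∅) := by
  intro n
  induction n with
  | zero =>
    intro A hLA hcard f g hf hg
    have hAL : A = L := by
      have h : A \ L = ∅ := Finset.card_eq_zero.mp hcard
      exact le_antisymm (by simpa [Finset.sdiff_eq_empty_iff_subset] using h) hLA
    subst hAL
    have hps : (A \ A).powerset = {∅} := by simp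
    rw [hps, Finset.sum_singleton, Finset.union_empty]
    -- the `if`-sum is the Harris sum minus the `s = A` term
    have hsplit : ∑ s ∈ A.powerset, (if A ⊆ s then 0 else (f s - f (A \ s)) * (g s - g (A \ s)))
        = (∑ s ∈ A.powerset, (f s - f (A \ s)) * (g s - g (A \ s))) - (f A - f ∅) * (g A - g ∅) := by
      have hmem : A ∈ A.powerset := Finset.mem_powerset.mpr (le_refl A)
      rw [← Finset.add_sum_erase _ _ hmem, ← Finset.add_sum_erase _ _ hmem]
      simp only [le_refl, if_true, Finset.sdiff_self]
      have hrest : ∑ s ∈ A.powerset.erase A, (if A ⊆ s then 0 else (f s - f (A \ s)) * (g s - g (A \ s)))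
          = ∑ s ∈ A.powerset.erase A, (f s - f (A \ s)) * (g s - g (A \ s)) := by
        refine Finset.sum_congr rfl fun s hs => ?_
        have hsA : s ⊆ A := Finset.mem_powerset.mp (Finset.mem_of_mem_erase hs)
        have hne : s ≠ A := Finset.ne_of_mem_erase hs
        have hnot : ¬ A ⊆ s := fun h => hne (le_antisymm hsA h)
        simp only [hnot, if_false]
      rw [hrest]
      simp
    rw [hsplit]
    have hH := harris_twoColouring_powerset A f g hf hg
    linarith
  | succ n ih =>
    intro A hLA hcard f g hf hg
    -- pick a pendant coordinate `e ∈ A \ L`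
    have hne : (A \ L).Nonempty := by
      rw [← Finset.card_pos, hcard]; exact Nat.succ_pos n
    obtain ⟨e, he⟩ := hne
    have heA : e ∈ A := (Finset.mem_sdiff.mp he).1
    have heL : e ∉ L := (Finset.mem_sdiff.mp he).2
    obtain ⟨A', hA'⟩ : ∃ A' : Finset ι, A' = A.erase e := ⟨_, rfl⟩
    have heA' : e ∉ A' := by rw [hA']; simp
    have hAins : A = insert e A' := by rw [hA', Finset.insert_erase heA]
    have hLA' : L ⊆ A' := by
      rw [hA']; intro i hi; exact Finset.mem_erase.mpr ⟨fun h => heL (h ▸ hi), hLA hi⟩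
    have hcard' : (A' \ L).card = n := by
      have h1 : A' \ L = (A \ L).erase e := by
        rw [hA']; ext i; simp only [Finset.mem_sdiff, Finset.mem_erase]; tauto
      rw [h1, Finset.card_erase_of_mem he, hcard]; rfl
    -- the peeled functions
    set f1 : Finset ι → ℝ := fun s => f (insert e s) with hf1
    set g1 : Finset ι → ℝ := fun s => g (insert e s) with hg1
    have hf1m : Monotone f1 := fun s t hst => hf (Finset.insert_subset_insert e hst)
    have hg1m : Monotone g1 := fun s t hst => hg (Finset.insert_subset_insert e hst)
    have ih1 := ih A' hLA' hcard' f1 g1 hf1m hg1m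
    have ih0 := ih A' hLA' hcard' f g hf hg
    -- split both sums of the goal along `e`
    have hsdiffA : A \ L = insert e (A' \ L) := by
      rw [hAins]; ext i; simp only [Finset.mem_sdiff, Finset.mem_insert]
      constructor
      · rintro ⟨h | h, hiL⟩
        · exact Or.inl h
        · exact Or.inr ⟨h, hiL⟩
      · rintro (h | ⟨h, hiL⟩)
        · exact ⟨Or.inl h, h ▸ heL⟩
        · exact ⟨Or.inr h, hiL⟩
    have heAL : e ∉ A' \ L := fun h => heA' (Finset.mem_sdiff.mp h).1
    rw [hsdiffA, Finset.sum_powerset_insert heAL, hAins, Finset.sum_powerset_insert heA']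
    -- compare term by term
    have hmain : ∑ s ∈ A'.powerset, (if L ⊆ s then 0 else (f s - f (insert e A' \ s)) * (g s - g (insert e A' \ s)))
        + ∑ s ∈ A'.powerset, (if L ⊆ insert e s then 0 else (f (insert e s) - f (insert e A' \ insert e s)) * (g (insert e s) - g (insert e A' \ insert e s)))
        ≥ (∑ s ∈ A'.powerset, (if L ⊆ s then 0 else (f1 s - f1 (A' \ s)) * (g1 s - g1 (A' \ s))))
          + ∑ s ∈ A'.powerset, (if L ⊆ s then 0 else (f s - f (A' \ s)) * (g s - g (A' \ s))) := by
      rw [← Finset.sum_add_distrib, ← Finset.sum_add_distrib]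
      apply Finset.sum_le_sum
      intro s hs
      have hsA' : s ⊆ A' := Finset.mem_powerset.mp hs
      have hes : e ∉ s := fun h => heA' (hsA' h)
      have hiff : (L ⊆ insert e s) ↔ (L ⊆ s) := by
        constructor
        · intro h i hi
          rcases Finset.mem_insert.mp (h hi) with h' | h'
          · exact absurd (h' ▸ hi) heL
          · exact h'
        · intro h; exact h.trans (Finset.subset_insert e s)
      by_cases hLs : L ⊆ s
      · simp only [hLs, hiff.mpr hLs, if_true, add_zero]; exact le_refl _
      · have hLs' : ¬ L ⊆ insert e s := fun h => hLs (hiff.mp h)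
        simp only [hLs, hLs', if_false]
        have e1 : insert e A' \ s = insert e (A' \ s) := by
          ext i; simp only [Finset.mem_sdiff, Finset.mem_insert]
          constructor
          · rintro ⟨h | h, his⟩
            · exact Or.inl h
            · exact Or.inr ⟨h, his⟩
          · rintro (h | ⟨h, his⟩)
            · exact ⟨Or.inl h, h ▸ hes⟩
            · exact ⟨Or.inr h, his⟩
        have e2 : insert e A' \ insert e s = A' \ s := by
          ext i; simp only [Finset.mem_sdiff, Finset.mem_insert, not_or]
          constructor
          · rintro ⟨h | h, hne, his⟩
            · exact absurd h hne
            · exact ⟨h, his⟩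
          · rintro ⟨h, his⟩
            exact ⟨Or.inr h, fun h' => heA' (h' ▸ h), his⟩
        rw [e1, e2]
        simp only [hf1, hg1]
        have := spade_pointwise (f (insert e s)) (f s) (f (insert e (A' \ s))) (f (A' \ s))
          (g (insert e s)) (g s) (g (insert e (A' \ s))) (g (A' \ s))
          (hf (Finset.subset_insert e s)) (hf (Finset.subset_insert e _)) (hg (Finset.subset_insert e s)) (hg (Finset.subset_insert e _))
        linarith
    have habs : ∑ J ∈ (A' \ L).powerset, (f1 (L ∪ J) - f1 ∅) * (g1 (L ∪ J) - g1 ∅)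
        ≤ ∑ J ∈ (A' \ L).powerset, (f (L ∪ insert e J) - f ∅) * (g (L ∪ insert e J) - g ∅) := by
      apply Finset.sum_le_sum
      intro J _
      simp only [hf1, hg1]
      have eq : L ∪ insert e J = insert e (L ∪ J) := by
        ext i; simp only [Finset.mem_union, Finset.mem_insert]; tauto
      rw [eq, Finset.insert_empty]
      exact absorber_mono _ _ _ _ _ _ (hf (Finset.empty_subset _)) (hf (Finset.singleton_subset_iff.mpr (Finset.mem_insert_self e _)))
        (hg (Finset.empty_subset _)) (hg (Finset.singleton_subset_iff.mpr (Finset.mem_insert_self e _)))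
    linarith [hmain, habs, ih1, ih0]

/-- **THEOREM ♠** (prim-lf-2 gen 27).  For finite `L ⊆ A` and monotone `f, g : Finset ι → ℝ`,
`0 ≤ Σ_{s ⊆ A, ¬ L ⊆ s} (f s − f (A ∖ s))(g s − g (A ∖ s)) + Σ_{J ⊆ A ∖ L} (f (L ∪ J) − f ∅)(g (L ∪ J) − g ∅)`:
the cube two-colouring form survives the removal of every pair whose red side contains `L`, at the price of one top absorber `(L ∪ J, ∅)` per
colouring `J` of the remaining coordinates (memo CW-NEGATIVE-gen27 §3: the LEMMA-G kernel with one free vertex of the bridge-and-pendant gadgets).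
[cite: KozmaNitzan2024, Questions 8–9 (§5.5 p. 36) (context: first rung of the coefficientwise programme for Question 8)] -/
theorem spade (A L : Finset ι) (hL : L ⊆ A) (f g : Finset ι → ℝ) (hf : Monotone f) (hg : Monotone g) :
    0 ≤ (∑ s ∈ A.powerset.filter (fun s => ¬ L ⊆ s), (f s - f (A \ s)) * (g s - g (A \ s)))
        + ∑ J ∈ (A \ L).powerset, (f (L ∪ J) - f ∅) * (g (L ∪ J) - g ∅) := by
  have h := spade_aux L _ A hL rfl f g hf hg
  rw [Finset.sum_filter]
  have hcongr : ∑ s ∈ A.powerset, (if ¬ L ⊆ s then (f s - f (A \ s)) * (g s - g (A \ s)) else 0)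
      = ∑ s ∈ A.powerset, (if L ⊆ s then 0 else (f s - f (A \ s)) * (g s - g (A \ s))) := by
    refine Finset.sum_congr rfl fun s _ => ?_
    by_cases hs : L ⊆ s <;> simp [hs]
  rw [hcongr]
  exact h

end Coefficientwise

end Summit.CriticalPhenomena.PercolationContinuityZ3.Theorems
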